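import Summits.AtomisticToContinuum.Crystallization.Theorems.HullExactificationCascadeRobustBarlowTemplateTransportSteps1

/-!
# Line `registered` (crux `RobustBarlowTemplate`, stmt-AtomisticToContinuum-12088): the four in-layer transports `I, J, I⁻¹, J⁻¹` and the vertical transport `V` of frames read in scale-relative integer charts (specifications, inverse identities, apexes) (part 3/7)

Helper lemmas for `develop_transport` (the geometric half of the development): frames
`⟨x, t₁, t₂, U⟩` read in the scale-relative integer charts `IsZChart` of an everywhere-good
configuration, their transports and the coherence of the resulting development `frameAt`.  The
only metric inputs are the chart transfer lemma `develop_transfer` and `bond_nb_iff`; everything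
else is label combinatorics in `ℤ³` (pattern facts `TransportPatterns*` of the sibling crux 9227,
imported verbatim).  All `[folklore]` (HalesDSP2012 §1.3 for the two kissing patterns).

PORT of the part of the same number of the closed sibling crux `ShellsToBarlowChart` (stmt-9227,
files `PalmUnimodularRigidityShellsToBarlowChartTransportSteps*.lean`) to the SCALE-RELATIVE shell
relation `y ∈ shell S x` of this crux (in place of the bond window
`0 < dist x y ∧ dist x y ≤ 28/25`) and to the five-argument charts `IsZChart S x P A nbr`; the port
rules (conjunct paths, `bond a b ↦ b ∈ shell S a`, the threaded symmetry hypothesis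
`hsy : ∀ x ∈ S, ∀ y ∈ shell S x, x ∈ shell S y` replacing `bond_symm`, `zchart_transfer` /
`zchart_sqNormInt_eq` replacing `sqNormInt_transfer` / `IsZChart.sqNormInt_eq`, the
`open … hiding …` line) are listed under "Port notes" in `…RobustBarlowTemplateTransportSteps1.lean`.

## Port notes (this part)
* none beyond those rules: signatures are parallel to the source with `hsy` inserted right after
  `hch`; bonds in conclusions became shell memberships (`nb x t₁ ∈ shell S x`,
  `nb x c₁ ∈ shell S (nb x t₁)`); the proofs are the source proofs verbatim up to the rules;
* the anchor at the end (explicit-`∀` form, registered sub-goal) is new.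
-/

noncomputable section

namespace Summit.AtomisticToContinuum.Crystallization.Theorems.HullExactificationCascadeRobustBarlowTemplate

open Literature.Geometry.DiscreteGeometry Literature.MathematicalPhysics.StatisticalMechanics
open Summit.AtomisticToContinuum.Crystallization.Theorems.PalmUnimodularRigidityShellsToBarlowChart hiding
  IsZChart TransportSystem scales_tied sqNormInt_transfer bond_symm nb_mem zlab_spec zlab_nb bond_nb_iff
  pattern_cases transfer_nb_nb transfer_nb_centre transfer_nb_target sqNormInt_zlab_centre hcp_of_mirror_pair

variable {S : Set (EuclideanSpace ℝ (Fin 3))} {Pc : (EuclideanSpace ℝ (Fin 3)) → Finset (Fin 3 → ℤ)}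
  {Ac : (EuclideanSpace ℝ (Fin 3)) → ((EuclideanSpace ℝ (Fin 3)) →ₗᵢ[ℝ] (EuclideanSpace ℝ (Fin 3)))} {nb : (EuclideanSpace ℝ (Fin 3)) → (Fin 3 → ℤ) → (EuclideanSpace ℝ (Fin 3))}

/-- **The J-step.**  For a valid frame `⟨x, t₁, t₂, U⟩` in the admissible regime (the target
pattern is FCC, or the source pattern is HCP, or — for the upper layers of the development — the
labels at the target of `x` and `nb x t₂` are already known to be symmetric), `Jstep` lands at
the shell point `y = nb x t₂`,
produces a valid frame of the SAME parity, the type propagates (`x` HCP ⇒ `y` HCP), and the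
labels at `y` of `x`, `nb x t₁`, `nb x (t₂ − t₁)` are `w`, `v`, `w − v` with `−w, −v` labels;
moreover the new upper cap is the cap of the label `μ` of the transported reference `nb x c₂`,
`c₂` the unique `U`-element touching `t₂`, and `μ` is its unique element touching `w`.
[folklore] -/
theorem Jstep_spec (hch : ∀ z ∈ S, IsZChart S z (Pc z) (Ac z) (nb z))
    (hsy : ∀ x ∈ S, ∀ y ∈ shell S x, x ∈ shell S y) {x : (EuclideanSpace ℝ (Fin 3))} (hx : x ∈ S) {t₁ t₂ : Fin 3 → ℤ} {U : Finset (Fin 3 → ℤ)} (hU : IsFrame (Pc x) t₁ t₂ U) (hreg : Pc (nb x t₂) = fcc3Int ∨ Pc x = hcpInt ∨ (-zlab Pc nb (nb x t₂) x ∈ Pc (nb x t₂) ∧ -zlab Pc nb (nb x t₂) (nb x t₁) ∈ Pc (nb x t₂))) : nb x t₂ ∈ S ∧ nb x t₂ ∈ shell S x ∧ zlab Pc nb (nb x t₂) x ∈ Pc (nb x t₂) ∧ nb (nb x t₂) (zlab Pc nb (nb x t₂) x) = x ∧ zlab Pc nb (nb x t₂) (nb x t₁) ∈ Pc (nb x t₂)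 ∧ nb (nb x t₂) (zlab Pc nb (nb x t₂) (nb x t₁)) = nb x t₁ ∧ -zlab Pc nb (nb x t₂) x ∈ Pc (nb x t₂) ∧ -zlab Pc nb (nb x t₂) (nb x t₁) ∈ Pc (nb x t₂) ∧ sqNormInt (zlab Pc nb (nb x t₂) x - zlab Pc nb (nb x t₂) (nb x t₁)) = 18 ∧ zlab Pc nb (nb x t₂) (nb x (t₂ - t₁)) = zlab Pc nb (nb x t₂) x - zlab Pc nb (nb x t₂) (nb x t₁) ∧ (Pc x = hcpInt → Pc (nb x t₂) = hcpInt) ∧ IsFrame (Pc (nb x t₂)) (Jstep Pc nb ⟨x, t₁, t₂, U⟩).t₁ (Jstep Pc nb ⟨x, t₁, t₂, U⟩).t₂ (Jstep Pc nb ⟨x, t₁, t₂, U⟩).U ∧ frameParity (Jstep Pc nb ⟨x, t₁, t₂, U⟩).t₁ (Jstep Pc nb ⟨x, t₁, t₂, U⟩).t₂ (Jstep Pc nb ⟨x, t₁, t₂, U⟩).U = frameParity t₁ t₂ U ∧ ∃ c₂ ∈ U, sqNormInt (c₂ - t₂) = 18 ∧ U.filter (fun e => sqNormInt (e - t₂)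 = 18) = {c₂} ∧ nb x c₂ ∈ shell S (nb x t₂) ∧ zlab Pc nb (nb x t₂) (nb x c₂) ∈ (Jstep Pc nb ⟨x, t₁, t₂, U⟩).U ∧ (Jstep Pc nb ⟨x, t₁, t₂, U⟩).U = capWithAny (Pc (nb x t₂)) (Jstep Pc nb ⟨x, t₁, t₂, U⟩).t₁ (Jstep Pc nb ⟨x, t₁, t₂, U⟩).t₂ {zlab Pc nb (nb x t₂) (nb x c₂)} ∧ (Jstep Pc nb ⟨x, t₁, t₂, U⟩).U.filter (fun e => sqNormInt (e + (Jstep Pc nb ⟨x, t₁, t₂, U⟩).t₂) = 18) = {zlab Pc nb (nb x t₂) (nb x c₂)} := by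
  obtain ⟨h12, hhex, hUP, hoff, c, hcU, hform⟩ := hU
  have hPx := pattern_cases hch hx
  -- hexagon memberships at `x`
  have ht₁ : t₁ ∈ Pc x := hhex (mem_hexLabels_iff.2 (Or.inl rfl))
  have ht₂ : t₂ ∈ Pc x := hhex (mem_hexLabels_iff.2 (Or.inr (Or.inl rfl)))
  have ht21 : t₂ - t₁ ∈ Pc x := hhex (mem_hexLabels_iff.2 (Or.inr (Or.inr (Or.inl rfl))))
  have hcP : c ∈ Pc x := hUP hcU
  have hc : c ∉ hexLabels t₁ t₂ := hoff c hcU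
  have hhx := dist_hexagon (Pc x) hPx t₁ ht₁ t₂ ht₂ h12 hhex
  -- the new site
  have hy := nb_mem hch hx ht₂
  have hPy := pattern_cases hch hy.1
  -- bonds from `y` to `I = nb x t₁`, `K = nb x (t₂ - t₁)`
  have h21 : sqNormInt (t₂ - t₁) = 18 := by rw [sqNormInt_sub_comm]; exact h12
  have hbJ : nb x t₁ ∈ shell S (nb x t₂) :=
    (bond_nb_iff hch hx ht₂ ht₁).2 h21
  have hbK : nb x (t₂ - t₁) ∈ shell S (nb x t₂) :=
    (bond_nb_iff hch hx ht₂ ht21).2 hhx.2.2.2.2.2.2.1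
  -- labels at `y`
  have hw := zlab_spec hch hy.1 hx (hsy _ hx _ hy.2)
  have hv := zlab_spec hch hy.1 (nb_mem hch hx ht₁).1 hbJ
  have hκ := zlab_spec hch hy.1 (nb_mem hch hx ht21).1 hbK
  set w := zlab Pc nb (nb x t₂) x with hw_def
  set v := zlab Pc nb (nb x t₂) (nb x t₁) with hv_def
  set κ := zlab Pc nb (nb x t₂) (nb x (t₂ - t₁)) with hκ_def
  -- transfers among `x, I, K`
  have Dvw : sqNormInt (v - w) = 18 := by
    rw [hv_def, hw_def, transfer_nb_centre hch hsy hx hy.1 hy.2 ht₁ hbJ, hhx.1]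
  have Dwv : sqNormInt (w - v) = 18 := by rw [sqNormInt_sub_comm]; exact Dvw
  have Dκw : sqNormInt (κ - w) = 18 := by
    rw [hκ_def, hw_def, transfer_nb_centre hch hsy hx hy.1 hy.2 ht21 hbK, h21]
  have Dvκ : sqNormInt (v - κ) = 54 := by
    rw [hv_def, hκ_def, transfer_nb_nb hch hsy hx hy.1 hy.2 ht₁ ht21 hbJ hbK]
    exact hhx.2.2.2.2.2.2.2.1
  have Dκv : sqNormInt (κ - v) = 54 := by rw [sqNormInt_sub_comm]; exact Dvκ
  -- the parity split on the source cap
  rcases hform with hE | hO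
  · /- EVEN source cap `U = {c, c - t₁, c - t₂}`: reference `c₂ = c` -/
    have hc1 : c - t₁ ∈ Pc x := hUP (by rw [hE]; simp)
    have hc2 : c - t₂ ∈ Pc x := hUP (by rw [hE]; simp)
    have hdx := dist_evenCap (Pc x) hPx t₁ ht₁ t₂ ht₂ c hcP h12 hhex hc hc1 hc2
    have hbu : nb x c ∈ shell S (nb x t₂) :=
      (bond_nb_iff hch hx ht₂ hcP).2 (by exact hdx.1)
    have hμ := zlab_spec hch hy.1 (nb_mem hch hx hcP).1 hbu
    set μ := zlab Pc nb (nb x t₂) (nb x c) with hμ_def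
    have Dμw : sqNormInt (μ - w) = 18 := by
      rw [hμ_def, hw_def, transfer_nb_centre hch hsy hx hy.1 hy.2 hcP hbu]
      exact zchart_sqNormInt_eq (hch x hx) hcP
    have Dwμ : sqNormInt (w - μ) = 18 := by rw [sqNormInt_sub_comm]; exact Dμw
    have Dvμ : sqNormInt (v - μ) = 18 := by
      rw [hv_def, hμ_def, transfer_nb_nb hch hsy hx hy.1 hy.2 ht₁ hcP hbJ hbu]; exact hdx.2.1
    -- regime: symmetric labels at `y` and type propagation
    have hsym : -w ∈ Pc (nb x t₂) ∧ -v ∈ Pc (nb x t₂) ∧ (Pc x = hcpInt → Pc (nb x t₂) = hcpInt) := by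
      by_cases hxh : Pc x = hcpInt
      · -- mirror pair through the lower cap
        have hfr : ∀ q, q ∈ hcpInt ↔ q ∈ Pc x := fun q => by rw [hxh]
        obtain ⟨d, hd, h48, hd1, hd2, hdoff, hL⟩ := lowerCap_evenCap_hcp t₁ ((hfr _).2 ht₁) t₂
          ((hfr _).2 ht₂) c ((hfr _).2 hcP) h12 (by rw [hxh] at hhex; exact hhex) hc
          ((hfr _).2 hc1) ((hfr _).2 hc2)
        have hdP : d ∈ Pc x := (hfr d).1 (mem_lowerCap_iff.1 hd).1
        have hdx' := dist_evenCap (Pc x) hPx t₁ ht₁ t₂ ht₂ d hdP h12 hhex hdoff ((hfr _).1 hd1)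
          ((hfr _).1 hd2)
        have hbl : nb x d ∈ shell S (nb x t₂) :=
          (bond_nb_iff hch hx ht₂ hdP).2 (by exact hdx'.1)
        obtain ⟨hPy', heq⟩ := hcp_of_mirror_pair hch hsy hx ht₂ hcP hdP h48 hbu hbl
        have hlam := zlab_spec hch hy.1 (nb_mem hch hx hdP).1 hbl
        have Dwlam : sqNormInt (w - zlab Pc nb (nb x t₂) (nb x d)) = 18 := by
          rw [sqNormInt_sub_comm, hw_def, transfer_nb_centre hch hsy hx hy.1 hy.2 hdP hbl]
          exact zchart_sqNormInt_eq (hch x hx) hdP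
        have Dvlam : sqNormInt (v - zlab Pc nb (nb x t₂) (nb x d)) = 18 := by
          rw [hv_def, transfer_nb_nb hch hsy hx hy.1 hy.2 ht₁ hdP hbJ hbl]; exact hdx'.2.1
        exact ⟨heq w hw.1 Dwμ Dwlam, heq v hv.1 Dvμ Dvlam, fun _ => hPy'⟩
      · have hS : -w ∈ Pc (nb x t₂) ∧ -v ∈ Pc (nb x t₂) := by
          rcases hreg with hA | hB | hS
          · constructor
            · rw [hA] at hw ⊢; exact neg_mem_fcc3Int w hw.1
            · rw [hA] at hv ⊢; exact neg_mem_fcc3Int v hv.1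
          · exact (hxh hB).elim
          · exact hS
        exact ⟨hS.1, hS.2, fun h => (hxh h).elim⟩
    obtain ⟨hnw, hnv, htype⟩ := hsym
    -- hexagon at `y` and the identity `κ = w - v`
    have hhexwv : hexLabels w v ⊆ Pc (nb x t₂) :=
      hexLabels_subset_of_symm (Pc (nb x t₂)) hPy w hw.1 v hv.1 Dwv hnw hnv
    have hwv : w - v ∈ Pc (nb x t₂) :=
      hhexwv (mem_hexLabels_iff.2 (Or.inr (Or.inr (Or.inr (Or.inr (Or.inr rfl))))))
    have hκeq : κ = w - v :=
      label_third_vertex (Pc (nb x t₂)) hPy v hv.1 w hw.1 κ hκ.1 Dvw Dκw Dκv hwv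
    -- the apex fact at `y` (J-orientation: frame `(v - w, -w)`)
    obtain ⟨hframe, hpar, hcap⟩ :=
      apex_J_even (Pc (nb x t₂)) hPy w hw.1 v hv.1 μ hμ.1 hnw hnv Dwv Dwμ Dvμ
    obtain ⟨-, -, -, hapoff, hμw, hμv⟩ :=
      apex_I_even (Pc (nb x t₂)) hPy w hw.1 v hv.1 μ hμ.1 hnw hnv Dwv Dwμ Dvμ
    -- the source filter and the computation of `Jstep`
    have hfilt : U.filter (fun e => sqNormInt (e - t₂) = 18) = {c} := by
      rw [hE]; exact (filter_evenCap (Pc x) hPx t₁ ht₁ t₂ ht₂ c hcP h12 hhex hc hc1 hc2).2.1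
    have hI : Jstep Pc nb ⟨x, t₁, t₂, U⟩ =
        ⟨nb x t₂, v - w, -w, ({μ - w, μ - v, μ} : Finset (Fin 3 → ℤ))⟩ := by
      have h1 : Jstep Pc nb ⟨x, t₁, t₂, U⟩ =
          ⟨nb x t₂, v - w, -w, capWithAny (Pc (nb x t₂)) (v - w) (-w) {μ}⟩ := by
        simp only [Jstep, hfilt, Finset.image_singleton]
        try rfl
      rw [h1, hcap]
    have hparx : frameParity t₁ t₂ U = 1 := by
      rw [hE]; exact (isFrame_evenCap (Pc x) hPx t₁ ht₁ t₂ ht₂ c hcP h12 hhex hc hc1 hc2).2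
    -- in the even cap `{c'', c'' - a, c'' - b}` (`a = v - w`, `b = -w`, `c'' = μ - w`) the element touching `-b = w` is `c'' - b = μ`
    have hapoff' : μ - w ∉ hexLabels (v - w) (-w) := by
      obtain ⟨-, -, -, hoff', _⟩ := id hframe
      exact hoff' (μ - w) (by simp)
    have hfilt' : ({μ - w, μ - v, μ} : Finset (Fin 3 → ℤ)).filter (fun e => sqNormInt (e + -w) = 18) = {μ} := by
      have := (filter_evenCap (Pc (nb x t₂)) hPy (v - w)
        (hhexwv (mem_hexLabels_iff.2 (Or.inr (Or.inr (Or.inl rfl))))) (-w) hnw (μ - w) hμw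
        (by rw [show v - w - -w = v by abel]; exact zchart_sqNormInt_eq (hch _ hy.1) hv.1)
        hframe.2.1 hapoff' (by rw [show μ - w - (v - w) = μ - v by abel]; exact hμv)
        (by rw [show μ - w - -w = μ by abel]; exact hμ.1)).2.2.2
      rw [show μ - w - -w = μ by abel, show μ - w - (v - w) = μ - v by abel] at this
      exact this
    refine ⟨hy.1, hy.2, hw.1, hw.2, hv.1, hv.2, hnw, hnv, Dwv, hκeq, htype, ?_, ?_, c, hcU,
      (by rw [sqNormInt_sub_comm]; exact hdx.1), hfilt, hbu, ?_, ?_, ?_⟩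
    · rw [hI]; exact hframe
    · rw [hI, hparx]; exact hpar
    · rw [hI]; show μ ∈ _; simp
    · rw [hI]; exact hcap.symm
    · rw [hI]; exact hfilt'
  · /- ODD source cap `U = {c, c + t₁, c + t₂}`: reference `c₂ = c + t₂` -/
    have hc1 : c + t₁ ∈ Pc x := hUP (by rw [hO]; simp)
    have hc2 : c + t₂ ∈ Pc x := hUP (by rw [hO]; simp)
    have hdx := dist_oddCap (Pc x) hPx t₁ ht₁ t₂ ht₂ c hcP h12 hhex hc hc1 hc2
    -- `c + t₂ ~ t₂` and `c + t₂ ~ t₂ - t₁`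
    have h_c1t1 : sqNormInt (c + t₂ - t₂) = 18 := by
      rw [add_sub_cancel_right]; exact zchart_sqNormInt_eq (hch x hx) hcP
    have hbu : nb x (c + t₂) ∈ shell S (nb x t₂) :=
      (bond_nb_iff hch hx ht₂ hc2).2 (by rw [sqNormInt_sub_comm]; exact h_c1t1)
    have hμ := zlab_spec hch hy.1 (nb_mem hch hx hc2).1 hbu
    set μ := zlab Pc nb (nb x t₂) (nb x (c + t₂)) with hμ_def
    have Dμw : sqNormInt (μ - w) = 18 := by
      rw [hμ_def, hw_def, transfer_nb_centre hch hsy hx hy.1 hy.2 hc2 hbu]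
      exact zchart_sqNormInt_eq (hch x hx) hc2
    have Dwμ : sqNormInt (w - μ) = 18 := by rw [sqNormInt_sub_comm]; exact Dμw
    have Dκμ : sqNormInt (κ - μ) = 18 := by
      rw [hκ_def, hμ_def, transfer_nb_nb hch hsy hx hy.1 hy.2 ht21 hc2 hbK hbu]; exact hdx.2.2.2.2.2.2.2.1
    have Dvμ : sqNormInt (v - μ) = 36 := by
      rw [hv_def, hμ_def, transfer_nb_nb hch hsy hx hy.1 hy.2 ht₁ hc2 hbJ hbu]; exact hdx.2.2.2.2.2.1
    -- regime: symmetric labels at `y` and type propagation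
    have hsym : -w ∈ Pc (nb x t₂) ∧ -v ∈ Pc (nb x t₂) ∧ (Pc x = hcpInt → Pc (nb x t₂) = hcpInt) := by
      by_cases hxh : Pc x = hcpInt
      · have hfr : ∀ q, q ∈ hcpInt ↔ q ∈ Pc x := fun q => by rw [hxh]
        obtain ⟨d, hd, h48, hd1, hd2, hdoff, hL⟩ := lowerCap_oddCap_hcp t₁ ((hfr _).2 ht₁) t₂
          ((hfr _).2 ht₂) c ((hfr _).2 hcP) h12 (by rw [hxh] at hhex; exact hhex) hc
          ((hfr _).2 hc1) ((hfr _).2 hc2)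
        have hdP : d ∈ Pc x := (hfr d).1 (mem_lowerCap_iff.1 hd).1
        have hd2P : d + t₂ ∈ Pc x := (hfr _).1 hd2
        have hdx' := dist_oddCap (Pc x) hPx t₁ ht₁ t₂ ht₂ d hdP h12 hhex hdoff ((hfr _).1 hd1) hd2P
        -- the lower reference `l = nb x (d + t₂)`, mirror partner of `u = nb x (c + t₂)`
        have h48' : sqNormInt (c + t₂ - (d + t₂)) = 48 := by
          rw [show c + t₂ - (d + t₂) = c - d by abel]; exact h48
        have hbl : nb x (d + t₂) ∈ shell S (nb x t₂) :=
          (bond_nb_iff hch hx ht₂ hd2P).2 (by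
            rw [sqNormInt_sub_comm, add_sub_cancel_right]; exact zchart_sqNormInt_eq (hch x hx) hdP)
        obtain ⟨hPy', heq⟩ := hcp_of_mirror_pair hch hsy hx ht₂ hc2 hd2P h48' hbu hbl
        have hlam := zlab_spec hch hy.1 (nb_mem hch hx hd2P).1 hbl
        have Dwlam : sqNormInt (w - zlab Pc nb (nb x t₂) (nb x (d + t₂))) = 18 := by
          rw [sqNormInt_sub_comm, hw_def, transfer_nb_centre hch hsy hx hy.1 hy.2 hd2P hbl]
          exact zchart_sqNormInt_eq (hch x hx) hd2P
        have Dκlam : sqNormInt (κ - zlab Pc nb (nb x t₂) (nb x (d + t₂))) = 18 := by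
          rw [hκ_def, transfer_nb_nb hch hsy hx hy.1 hy.2 ht21 hd2P hbK hbl]; exact hdx'.2.2.2.2.2.2.2.1
        have hnw : -w ∈ Pc (nb x t₂) := heq w hw.1 Dwμ Dwlam
        have hnκ : -κ ∈ Pc (nb x t₂) := heq κ hκ.1 Dκμ Dκlam
        have hnv : -v ∈ Pc (nb x t₂) := by
          have hwP := hw.1; have hκP := hκ.1; have hvP := hv.1
          rw [hPy'] at hwP hκP hvP hnw hnκ ⊢
          exact neg_mem_of_chain w hwP κ hκP v hvP hnw hnκ Dwv (by rw [sqNormInt_sub_comm]; exact Dκw) Dvκ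
        exact ⟨hnw, hnv, fun _ => hPy'⟩
      · have hS : -w ∈ Pc (nb x t₂) ∧ -v ∈ Pc (nb x t₂) := by
          rcases hreg with hA | hB | hS
          · constructor
            · rw [hA] at hw ⊢; exact neg_mem_fcc3Int w hw.1
            · rw [hA] at hv ⊢; exact neg_mem_fcc3Int v hv.1
          · exact (hxh hB).elim
          · exact hS
        exact ⟨hS.1, hS.2, fun h => (hxh h).elim⟩
    obtain ⟨hnw, hnv, htype⟩ := hsym
    have hhexwv : hexLabels w v ⊆ Pc (nb x t₂) :=
      hexLabels_subset_of_symm (Pc (nb x t₂)) hPy w hw.1 v hv.1 Dwv hnw hnv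
    have hwv : w - v ∈ Pc (nb x t₂) :=
      hhexwv (mem_hexLabels_iff.2 (Or.inr (Or.inr (Or.inr (Or.inr (Or.inr rfl))))))
    have hκeq : κ = w - v :=
      label_third_vertex (Pc (nb x t₂)) hPy v hv.1 w hw.1 κ hκ.1 Dvw Dκw Dκv hwv
    have Dwvμ : sqNormInt (w - v - μ) = 18 := by rw [← hκeq]; exact Dκμ
    obtain ⟨hframe, hpar, hcap⟩ :=
      apex_J_odd (Pc (nb x t₂)) hPy w hw.1 v hv.1 μ hμ.1 hnw hnv Dwv Dwμ Dwvμ Dvμ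
    have hfilt : U.filter (fun e => sqNormInt (e - t₂) = 18) = {c + t₂} := by
      rw [hO]; exact (filter_oddCap (Pc x) hPx t₁ ht₁ t₂ ht₂ c hcP h12 hhex hc hc1 hc2).2.1
    have hI : Jstep Pc nb ⟨x, t₁, t₂, U⟩ =
        ⟨nb x t₂, v - w, -w, ({μ, μ + v - w, μ - w} : Finset (Fin 3 → ℤ))⟩ := by
      have h1 : Jstep Pc nb ⟨x, t₁, t₂, U⟩ =
          ⟨nb x t₂, v - w, -w, capWithAny (Pc (nb x t₂)) (v - w) (-w) {μ}⟩ := by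
        simp only [Jstep, hfilt, Finset.image_singleton]
        try rfl
      rw [h1, hcap]
    have hparx : frameParity t₁ t₂ U = -1 := by
      rw [hO]; exact (isFrame_oddCap (Pc x) hPx t₁ ht₁ t₂ ht₂ c hcP h12 hhex hc hc1 hc2).2
    -- in the odd cap `{μ, μ + a, μ + b}` (`a = v - w`, `b = -w`) the element touching `-b = w` is `μ`
    have hfilt' : ({μ, μ + v - w, μ - w} : Finset (Fin 3 → ℤ)).filter (fun e => sqNormInt (e + -w) = 18) = {μ} := by
      obtain ⟨-, -, -, hoff', _⟩ := id hframe
      have hμoff : μ ∉ hexLabels (v - w) (-w) := hoff' μ (by simp)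
      have := (filter_oddCap (Pc (nb x t₂)) hPy (v - w)
        (hhexwv (mem_hexLabels_iff.2 (Or.inr (Or.inr (Or.inl rfl))))) (-w) hnw μ hμ.1
        (by rw [show v - w - -w = v by abel]; exact zchart_sqNormInt_eq (hch _ hy.1) hv.1)
        hframe.2.1 hμoff (by rw [show μ + (v - w) = μ + v - w by abel]; exact hframe.2.2.1 (by simp))
        (by rw [show μ + -w = μ - w by abel]; exact hframe.2.2.1 (by simp))).2.2.2
      rw [show μ + -w = μ - w by abel, show μ + (v - w) = μ + v - w by abel] at this
      exact this
    refine ⟨hy.1, hy.2, hw.1, hw.2, hv.1, hv.2, hnw, hnv, Dwv, hκeq, htype, ?_, ?_, c + t₂,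
      (by rw [hO]; simp), h_c1t1, hfilt, hbu, ?_, ?_, ?_⟩
    · rw [hI]; exact hframe
    · rw [hI, hparx]; exact hpar
    · rw [hI]; show μ ∈ _; simp
    · rw [hI]; exact hcap.symm
    · rw [hI]; exact hfilt'

/-! ## Anchor -/

/-- Anchor (registered sub-goal of stmt-AtomisticToContinuum-12088): in a charted configuration
with symmetric shells, the J-step of a valid frame whose target chart is FCC or whose source chart
is HCP is a valid frame of the target chart. [folklore] -/
theorem transportSteps3_anchor : ∀ (S : Set (EuclideanSpace ℝ (Fin 3))) (Pc : EuclideanSpace ℝ (Fin 3) → Finset (Fin 3 → ℤ)) (Ac : EuclideanSpace ℝ (Fin 3) → (EuclideanSpace ℝ (Fin 3) →ₗᵢ[ℝ] EuclideanSpace ℝ (Fin 3))) (nb : EuclideanSpace ℝ (Fin 3) → (Fin 3 → ℤ) → EuclideanSpace ℝ (Fin 3)), (∀ z ∈ S, IsZChart S z (Pc z) (Ac z) (nb z)) → (∀ x ∈ S, ∀ y ∈ shell S x, x ∈ shell S y) → ∀ x ∈ S, ∀ (t₁ t₂ : Fin 3 → ℤ) (U : Finset (Fin 3 → ℤ)),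 IsFrame (Pc x) t₁ t₂ U → (Pc (nb x t₂) = fcc3Int ∨ Pc x = hcpInt) → IsFrame (Pc (nb x t₂)) (Jstep Pc nb ⟨x, t₁, t₂, U⟩).t₁ (Jstep Pc nb ⟨x, t₁, t₂, U⟩).t₂ (Jstep Pc nb ⟨x, t₁, t₂, U⟩).U :=
  fun _ _ _ _ hch hsy _ hx _ _ _ hU hreg =>
    (Jstep_spec hch hsy hx hU (hreg.imp_right Or.inl)).2.2.2.2.2.2.2.2.2.2.2.1

end Summit.AtomisticToContinuum.Crystallization.Theorems.HullExactificationCascadeRobustBarlowTemplate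

end
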